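import Summits.ABC.IUTFork.Cor312ThetaSlotExactM
import Summits.ABC.IUTFork.Cor312StatementGenuineM
import HarnessLib

/-!
# [IUTchIII] Corollary 3.12 IN READING (P) AT THE M-LEVEL GENUINE REAL SETTING implies the PER-IMAGE Dupuy–Hilado inequality of the datum:
# `SlotStatement (setting of the datum's own ideles) → I.Cor312PerImageOf` and `SlotLicence (…) → I.Cor312PerImageOf` — NO hypothesis

PROOF-ONLY file (D-0012; no definitions, no `Prop` facts) of the abc-iut cell (branch C certificate seat abc-iut-C-cert-2 gen 4; the M-LEVEL SLOT READ,
sequel: the per-datum ROUTE of the γ / joint M twins). TAKES NO SIDE on [IUTchIII] Cor. 3.12 or on the reading (U)/(P) of `−|log(Θ)|`.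

The reading-(P) twin of abc-iut-w5-d244's `Cor312StatementGenuineM` (p449545: `Statement (M setting of I's own ideles) → I.Cor312Of`, NO hypothesis)
and the M-level twin of this seat's per-datum lemmas `Conditional.GenuineKSlot.cor312PerImageOf_of_slotStatement / _of_slotLicence`
(`AbcOfSlotLicenceGenuineK`, p458998; there modulo the READ-P binder, discharged at the K level by abc-iut-s2-p7 p462377). At abc-iut-s2-p8's
summand-route M-level sharp setting `settingPrVolSharpM` of a volume input `I` of the initial Θ-data `D` (Θ-ideles `tOfIdeleData D (ideleDataOf D hI)`,
`q`-ideles `tqM … (ideleDataOf D hI)` of abc-iut-w5-d033; ANY context binders, any finite `Sq` off which the `q`-ideles are units):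
* the `q`-side is abc-iut-w5-d244's number theorem `negLogQ_settingPrVolSharpM_ideleDataOf_eq_negAbsLogQ` (`P.negLogQ = I.negAbsLogQ`);
* the Θ-side IN READING (P) is this seat's `negLogThetaSlot_settingPrVolSharpM_le_negLogThetaPerImage_of_isVolumeInputOf` (`Cor312ThetaSlotExactM`:
  `P.negLogThetaSlot = ↑I.negLogThetaPerImageNonarch ≤ ↑I.negLogThetaPerImage`, UNCONDITIONAL).
Hence: `slotStatement_settingPrVolSharpM_iff_negAbsLogQ_le` (the typed (P)-statement REFORMULATED IN NUMBERS),
**`cor312PerImageOf_of_slotStatement_settingPrVolSharpM`** (`SlotStatement → I.Cor312PerImageOf`) and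
**`cor312PerImageOf_of_slotLicence_settingPrVolSharpM`** (`SlotLicence → I.Cor312PerImageOf`: monotone log-volume = abc-iut-s2-p8's
`bridgeHyps_settingPrVolSharpM_of_ideles …|>.mono`, `ThetaSlotFinite` = this seat's `thetaSlotFinite_settingPrVolSharpM_of_isVolumeInputOf`, then
abc-iut-C-cert-2's `slotStatement_of_slotLicence`). The converse is NOT claimed (the archimedean summand `((l+5)/4)·log π` is one-sided slack).

[cite: Mochizuki2012, IUTchIII Cor. 3.12 p. 173–174, proof Step (x) p. 181, Step (xi-f) p. 184; Prop. 3.9 (ii) p. 126] [cite: Mochizuki2012, IUTchIV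
Thm. 1.10 p. 23, Steps (v)–(viii) p. 27–31] [cite: DupuyHilado2025, §1 (1.1), §3.9, Thm. 3.10.1 (iii), §4.11–4.12] [claim: Mochizuki2012, status: disputed]
for every quoted construction. HONEST FRAMING: implications between OUR typed (P)-statement / slot licence of OUR typed M-level setting and abc-iut-S7's
DEFINED per-image inequality; `SlotLicence` / `SlotStatement` are STRONGER-THAN-PRINT readings (print: hull of the union of ALL possible images); nothing
here asserts or denies [IUTchIII] Cor. 3.12 for any initial Θ-data or takes a side on any author; typed ≠ proved; instantiated ≠ endorsed.
-/

noncomputable section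

open Set Function NumberField IsDedekindDomain

namespace Summit.ABC.IUTFork.Thm311.Real

open Cor312 Cor312Vol Cor312Prov Literature.IUT.LogThetaLattice Literature.IUT.LogVolume Literature.IUT.HodgeTheaters
  Literature.NumberTheory.NumberFields

variable {F K Fbar : Type} [Field F] [NumberField F] [Field K] [NumberField K] [Algebra F K]
  [Field Fbar] [Algebra F Fbar] [Algebra K Fbar] {E : WeierstrassCurve F} [E.IsElliptic] {l : ℕ}
  {Pb : BadPlacePredicates K} (D : InitialThetaData F K Fbar E l Pb) {logvK : PadicLogsVal K}
  (hlog : LogvAnalyticVal logvK) {I : ThetaVolumeInput (fieldOfModuli E) K} (hI : ThetaData.IsVolumeInputOf D I)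
  (M : Type) [Field M] [NumberField M]
  (archPk : ∀ (j : (thetaIndexOfInitial D).Label) (vQ : (thetaIndexOfInitial D).VQ),
    Set ((logShellsOfInitialDH D logvK).Packet j vQ))
  (archSub : ∀ (j : (thetaIndexOfInitial D).Label) (v : (thetaIndexOfInitial D).V),
    Set ((logShellsOfInitialDH D logvK).Packet j ((thetaIndexOfInitial D).over v)))
  (Ψ : ℤ → ∀ v : (thetaIndexOfInitial D).V, v ∈ (thetaIndexOfInitial D).Vbad →
    Set ((logShellsOfInitialDH D logvK).StarPacket v))
  (act : ℤ → ∀ v : (thetaIndexOfInitial D).V, v ∈ (thetaIndexOfInitial D).Vbad →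
    (logShellsOfInitialDH D logvK).StarPacket v → Module.End ℚ ((logShellsOfInitialDH D logvK).StarPacket v))
  (Mmod : ℤ → ∀ j : (thetaIndexOfInitial D).LabelStar, Set ((logShellsOfInitialDH D logvK).GlobalPacket j.1))
  (region : ℤ → ∀ j : (thetaIndexOfInitial D).LabelStar, FinDivisor M → ∀ vQ : (thetaIndexOfInitial D).VQ,
    Set ((logShellsOfInitialDH D logvK).Packet j.1 vQ))
  (n : ℤ) {HT : Type} {LogLink : HT → HT → Type} {IsFull : ∀ {s t : HT}, LogLink s t → Prop}
  (lat : LGPGaussianLogThetaLattice LogLink IsFull)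
  {Frd : Type} {IsoF : Frd → Frd → Type} {Ob : Frd → Type} {realify : Frd → Frd} {Strip : Type}
  {IsoS : Strip → Strip → Type}
  {Mv : ∀ v : (thetaIndexOfInitial D).V, v ∈ (thetaIndexOfInitial D).Vbad → Type} [∀ v h, Monoid (Mv v h)]
  (sig : GlobalLGPFrobenioidSignature (thetaIndexOfInitial D).lstar (thetaIndexOfInitial D).V
    (· ∈ (thetaIndexOfInitial D).Vbad) Frd IsoF Ob realify Strip IsoS Mv)
  (split : SplittingMonoids Mv) {ObΔ : Type}
  {N : ∀ v : (thetaIndexOfInitial D).V, v ∈ (thetaIndexOfInitial D).Vbad → Type} [∀ v h, Monoid (N v h)]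
  (qData : QPilotData ObΔ N)
  (Sq : Finset (FinitePlace ℚ))
  (htq1 : ∀ (u : FinitePlace ℚ) (x : (thetaIndexOfInitial D).Fibre (Val.non u)), u ∉ Sq →
    ‖tqM D (ratChar u) u (natCast_ratChar_mem u) (ideleDataOf D hI) x‖ = 1)

/-- **The typed Cor. 3.12 IN READING (P) at the summand-route M-level genuine setting, REFORMULATED IN NUMBERS**: `SlotStatement ↔
(−|log(Θ)|^{(P)} ≠ ⊤ ∧ ↑I.negAbsLogQ ≤ −|log(Θ)|^{(P)})` — the `q`-side of the setting IS abc-iut-S2's `I.negAbsLogQ` (abc-iut-w5-d244 P5-numbers).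
[cite: Mochizuki2012, IUTchIII Cor. 3.12 p. 174, proof Step (x) p. 181] -/
theorem slotStatement_settingPrVolSharpM_iff_negAbsLogQ_le :
    (settingPrVolSharpM D hlog (tOfIdeleData D (ideleDataOf D hI))
        (fun u x => tqM D (ratChar u) u (natCast_ratChar_mem u) (ideleDataOf D hI) x) M archPk archSub Ψ act Mmod region n lat sig split
        qData (fun u x => tqM_ne_zero D (ratChar u) u (natCast_ratChar_mem u) (ideleDataOf D hI) x) Sq htq1).SlotStatement ↔
      (settingPrVolSharpM D hlog (tOfIdeleData D (ideleDataOf D hI))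
          (fun u x => tqM D (ratChar u) u (natCast_ratChar_mem u) (ideleDataOf D hI) x) M archPk archSub Ψ act Mmod region n lat sig split
          qData (fun u x => tqM_ne_zero D (ratChar u) u (natCast_ratChar_mem u) (ideleDataOf D hI) x) Sq htq1).negLogThetaSlot ≠ ⊤ ∧
        ((I.negAbsLogQ : ℝ) : WithTop ℝ) ≤
          (settingPrVolSharpM D hlog (tOfIdeleData D (ideleDataOf D hI))
            (fun u x => tqM D (ratChar u) u (natCast_ratChar_mem u) (ideleDataOf D hI) x) M archPk archSub Ψ act Mmod region n lat sig split
            qData (fun u x => tqM_ne_zero D (ratChar u) u (natCast_ratChar_mem u) (ideleDataOf D hI) x) Sq htq1).negLogThetaSlot := by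
  unfold Setting.SlotStatement
  rw [negLogQ_settingPrVolSharpM_ideleDataOf_eq_negAbsLogQ]

/-- **[IUTchIII] Cor. 3.12 IN READING (P) AT THE SUMMAND-ROUTE M-LEVEL GENUINE SETTING IMPLIES THE PER-IMAGE DUPUY–HILADO INEQUALITY OF THE DATUM**:
for a volume input `I` of the initial Θ-data `D`, if the typed `SlotStatement` holds at abc-iut-s2-p8's `settingPrVolSharpM` with the pilot regions read
off `I`'s own ideles (ANY context binders), then `I.Cor312PerImageOf` (`−|log(q)| ≤ −|log(Θ)|^{(P)}` of abc-iut-S7's genuine per-image numbers). NO hypothesis: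
the `q`-side is abc-iut-w5-d244's number theorem, the Θ-side this seat's `negLogThetaSlot_settingPrVolSharpM_le_negLogThetaPerImage_of_isVolumeInputOf`.
The M twin of `Conditional.GenuineKSlot.cor312PerImageOf_of_slotStatement` (there modulo READ-P). [cite: Mochizuki2012, IUTchIII Cor. 3.12 p. 173–174,
proof Step (x) p. 181] [cite: DupuyHilado2025, §1 (1.1), §4.12] -/
theorem cor312PerImageOf_of_slotStatement_settingPrVolSharpM
    (hst : (settingPrVolSharpM D hlog (tOfIdeleData D (ideleDataOf D hI))
        (fun u x => tqM D (ratChar u) u (natCast_ratChar_mem u) (ideleDataOf D hI) x) M archPk archSub Ψ act Mmod region n lat sig split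
        qData (fun u x => tqM_ne_zero D (ratChar u) u (natCast_ratChar_mem u) (ideleDataOf D hI) x) Sq htq1).SlotStatement) :
    I.Cor312PerImageOf := by
  obtain ⟨-, hle⟩ := (slotStatement_settingPrVolSharpM_iff_negAbsLogQ_le D hlog hI M archPk archSub Ψ act Mmod region n lat sig split qData Sq
    htq1).mp hst
  have hΘ := negLogThetaSlot_settingPrVolSharpM_le_negLogThetaPerImage_of_isVolumeInputOf D hlog
    (fun u x => tqM D (ratChar u) u (natCast_ratChar_mem u) (ideleDataOf D hI) x) M archPk archSub Ψ act Mmod region n lat sig split qData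
    (fun u x => tqM_ne_zero D (ratChar u) u (natCast_ratChar_mem u) (ideleDataOf D hI) x) Sq htq1 hI
  exact WithTop.coe_le_coe.mp (hle.trans hΘ)

/-- **`ThetaSlotFinite`** at the summand-route M-level genuine setting of `I`'s own ideles (this seat's `Cor312ThetaSlotExactM`, restated with the
`q`-ideles `tqM … (ideleDataOf D hI)`). [claim: Mochizuki2012, status: disputed] -/
theorem thetaSlotFinite_settingPrVolSharpM_ideleDataOf :
    (settingPrVolSharpM D hlog (tOfIdeleData D (ideleDataOf D hI))
        (fun u x => tqM D (ratChar u) u (natCast_ratChar_mem u) (ideleDataOf D hI) x) M archPk archSub Ψ act Mmod region n lat sig split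
        qData (fun u x => tqM_ne_zero D (ratChar u) u (natCast_ratChar_mem u) (ideleDataOf D hI) x) Sq htq1).ThetaSlotFinite :=
  thetaSlotFinite_settingPrVolSharpM_of_isVolumeInputOf D hlog
    (fun u x => tqM D (ratChar u) u (natCast_ratChar_mem u) (ideleDataOf D hI) x) M archPk archSub Ψ act Mmod region n lat sig split qData
    (fun u x => tqM_ne_zero D (ratChar u) u (natCast_ratChar_mem u) (ideleDataOf D hI) x) Sq htq1 hI

/-- **The SLOT LICENCE at the summand-route M-level genuine setting implies the typed (P)-statement there** — `SlotLicence → SlotStatement`, NO further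
hypothesis: monotone log-volume is abc-iut-s2-p8's `bridgeHyps_settingPrVolSharpM_of_ideles …|>.mono` (a THEOREM at the genuine carriers), finiteness of
`−|log(Θ)|^{(P)}` is `thetaSlotFinite_settingPrVolSharpM_ideleDataOf`, then abc-iut-C-cert-2's `Cor312.Setting.slotStatement_of_slotLicence`
([IUTchIII] Prop. 3.9 (ii): monotonicity of the log-volume). [cite: Mochizuki2012, IUTchIII Prop. 3.9 (ii) p. 126; Cor. 3.12 Step (xi-f) p. 184] -/
theorem slotStatement_of_slotLicence_settingPrVolSharpM
    (hlic : (settingPrVolSharpM D hlog (tOfIdeleData D (ideleDataOf D hI))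
        (fun u x => tqM D (ratChar u) u (natCast_ratChar_mem u) (ideleDataOf D hI) x) M archPk archSub Ψ act Mmod region n lat sig split
        qData (fun u x => tqM_ne_zero D (ratChar u) u (natCast_ratChar_mem u) (ideleDataOf D hI) x) Sq htq1).SlotLicence) :
    (settingPrVolSharpM D hlog (tOfIdeleData D (ideleDataOf D hI))
        (fun u x => tqM D (ratChar u) u (natCast_ratChar_mem u) (ideleDataOf D hI) x) M archPk archSub Ψ act Mmod region n lat sig split
        qData (fun u x => tqM_ne_zero D (ratChar u) u (natCast_ratChar_mem u) (ideleDataOf D hI) x) Sq htq1).SlotStatement :=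
  Cor312.Setting.slotStatement_of_slotLicence _
    (bridgeHyps_settingPrVolSharpM_of_ideles D hlog (tOfIdeleData D (ideleDataOf D hI))
      (fun u x => tqM D (ratChar u) u (natCast_ratChar_mem u) (ideleDataOf D hI) x) M archPk archSub Ψ act Mmod region n lat sig split qData
      (fun u x => tqM_ne_zero D (ratChar u) u (natCast_ratChar_mem u) (ideleDataOf D hI) x) Sq htq1 (tOfIdeleData_ne_zero D (ideleDataOf D hI))
      _ (fun u i x hu => norm_tOfIdeleData_eq_one_of_not_mem_image_badPrimesMod D (ideleDataOf D hI) u i x hu)).mono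
    (thetaSlotFinite_settingPrVolSharpM_ideleDataOf D hlog hI M archPk archSub Ψ act Mmod region n lat sig split qData Sq htq1) hlic

/-- **THE SLOT LICENCE AT THE SUMMAND-ROUTE M-LEVEL GENUINE SETTING IMPLIES THE PER-IMAGE DUPUY–HILADO INEQUALITY OF THE DATUM** — `SlotLicence →
I.Cor312PerImageOf`, NO hypothesis (the two theorems above). The M twin of `Conditional.GenuineKSlot.cor312PerImageOf_of_slotLicence` (there modulo
READ-P). So on the M line, at every genuine datum where OUR slot licence HOLDS, the per-image number-level Corollary is a THEOREM; the γ / joint M twins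
assume it only where the slot licence FAILS. [cite: Mochizuki2012, IUTchIII Cor. 3.12 p. 173–174, Step (xi-f) p. 184] [cite: DupuyHilado2025, §1 (1.1), §4.12] -/
theorem cor312PerImageOf_of_slotLicence_settingPrVolSharpM
    (hlic : (settingPrVolSharpM D hlog (tOfIdeleData D (ideleDataOf D hI))
        (fun u x => tqM D (ratChar u) u (natCast_ratChar_mem u) (ideleDataOf D hI) x) M archPk archSub Ψ act Mmod region n lat sig split
        qData (fun u x => tqM_ne_zero D (ratChar u) u (natCast_ratChar_mem u) (ideleDataOf D hI) x) Sq htq1).SlotLicence) :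
    I.Cor312PerImageOf :=
  cor312PerImageOf_of_slotStatement_settingPrVolSharpM D hlog hI M archPk archSub Ψ act Mmod region n lat sig split qData Sq htq1
    (slotStatement_of_slotLicence_settingPrVolSharpM D hlog hI M archPk archSub Ψ act Mmod region n lat sig split qData Sq htq1 hlic)

end Summit.ABC.IUTFork.Thm311.Real

end
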